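import Summits.ResolutionOfSingularities.ResolutionOfSingularities.Theses.WildCones
import Summits.ResolutionOfSingularities.ResolutionOfSingularities.Theorems.NarrowRunsDie.Negative.FalseWithoutIsol
import Summits.ResolutionOfSingularities.ResolutionOfSingularities.Theorems.NarrowRunsDie.Negative.NoUniformBound

/-!
# Disproof of `NarrowRunsDie` (crux stmt-ResolutionOfSingularities-16882, route `WildCones`) —
# findings: NO KILL; the crux RESISTS and is believed TRUE; `Isol` is load-bearing (landed
# `Negative/FalseWithoutIsol.lean`, p153198); NO UNIFORM BOUND — isolated narrow runs of every
# finite length (landed `Negative/NoUniformBound.lean` + `FuelFamilyRun/FuelFamilyNarrow/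
# JacobianQuotientFinite`); `MultP`, `dL = 1` load-bearing on paper; `p ≠ 2`, `3 ≤ n`,
# `PerfectField`, `OrdP`, and `Isol` beyond stage `0` are NOT.

Crux (verbatim `WildCones.NarrowRunsDie`): `p` odd prime, `n ≥ 3`, `κ` perfect of char `p`;
no run of the inlined point-blow-up calculus (`step = clean ∘ tr ∘ dv ∘ bl`, `run` its iterate
along a chart word `i` and a translation word `t`) has all states `Isol ∧ MultP` and all states
`OrdP ∧ dL = 1`.

## 0. Model read-back (no junk found)
`bl i` is the chart-`i` blow-up on exponents (`B ↦ (…, |B|, …)`, guarded natural subtraction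
correct), `dv i p` divides by `u_i^p`, `tr i τ p` is the Taylor shift `u_j ↦ u_j + τ_j (j ≠ i)` —
its finite box `D_j ≤ B_i + p` loses NO term (after `bl ∘ dv`, a non-zero coefficient at `B + D`
forces `Σ_{j≠i} (B_j + D_j) ≤ B_i + p`), `clean` deletes `p`-th-power monomials (= the ambient
shift `z ↦ z − Σ c^{1/p} u^A` over perfect `κ`), `ord` is `sInf` (`= 0` only on the zero state,
excluded by `MultP`), `Isol c` is `m`-primarity of the Jacobian ideal of `clean c` in `κ[[u]]`,
`cone/Linv/dL` are the degree-`p` part `G`, its additive-invariance set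
`{w | G(X + wS) = G(X) + G(w) S^p}` (κ-rational points) and the `finrank` of its span. The
dictionary state ↔ (strict transform `X_m`, centre `x_m`) is exact: the `u_i`-charts cover
`X' ∩ E` (the `z`-chart point `(1:0:…:0)` is off `X'` since `ord a ≥ p`), every `κ`-point of
`X' ∩ E ∩ {chart i}` is `(z' = (−G(v))^{1/p}, u_i = 0, u' = τ')`, reached by `(i, τ)`.

## 1. Why it resists — the proof the attacks kept running into (4 steps; = refuter g2's lemma,
## the `birth`/`derivlift` lines; re-derived independently here, checked against the conventions)
Write `G_m = cone (run m)`, `v_m = e_{i m} + Σ_{j ≠ i m} t m j · e_j`, `H = {w | w_{i m} = 0}`,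
`Ḡ = G_m|_H`.
1. NEAR ⇒ INVARIANT. `MultP (run (m+1))` read on the `u_{i m}`-free monomials of the transform
   `Σ_d u_i^{d−p} a_d(v + u')` says `clean(G_m(v_m + u'))` is homogeneous of degree `p` on `H`, i.e.
   `G_m(v_m + u') = G_m(v_m) + Ḡ(u')`; homogenising (`X = X_i v + (X − X_i v)`):
   `G_m(X) = X_i^p G_m(v_m) + Ḡ(X − X_i v_m)`, whence `G_m(X + S v_m) = G_m(X) + S^p G_m(v_m)`
   (`(X_i + S)^p = X_i^p + S^p`): `v_m ∈ Linv (run m)`. [uses MultP at m (so `s = p`) and m+1]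
2. TRANSVERSAL SPLITTING. The same identity gives `Linv(G_m) ⊇ κ v_m ⊕ L_H(Ḡ)`; `dL = 1` and
   `v_m ≠ 0` (its `i m`-coordinate is `1`) force `span Linv = κ v_m`, so `L_H(Ḡ) = 0`.
3. SATELLITE EXCLUSION. `cone (run (m+1)) = Ḡ(u') + u_i · R` (the degree-`p` part of
   `u_i^{d−p} a_d(v+u')` is divisible by `u_i` for `d > p`; cleaning only removes `u_i^p · const`) —
   unconditionally. So `w ∈ Linv (run (m+1))` with `w_{i m} = 0` satisfies, at `X_i = 0`, the
   `L_H(Ḡ)` identity: `w = 0`. Hence `v_{m+1} ∉ H`: `i (m+1) = i m ∨ t (m+1) (i m) ≠ 0` — EVERY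
   step of a narrow run is FREE (the planner's feared "tangential d = 1 recurrence" cannot occur,
   whatever the higher Taylor data).
4. ARC. A free infinite sequence of infinitely near points of the smooth ambient germ
   `Spf κ[[z,u]]` is the sequence of infinitely near points of ONE smooth formal arc `Γ`
   (push down the line `s ↦ s·v_M` from stage `M`; freeness = `ord_s` of the old chart coordinate
   stays `1`; the jets stabilise). Multiplicity `p` of `X_m` at every point of `Γ` reads, in
   coordinates adapted to `Γ`, `B_0 + (m+1)(|B'| − p) ≥ 0 ∀ m` on the monomials of `F = z^p + a`,
   so `F ∈ I_Γ^p`; then `Γ ⊂ X`, `Γ` is not vertical (tangent `v_0` has `u_{i 0}`-coordinate 1),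
   `∂_j a ∈ I_γ` for the smooth arc `γ = pr(Γ)`, and `κ[[u]]/(∂a) ↠ κ[[s]]` is not finite:
   `¬ Isol (run 0)`.
USES: `MultP` at all stages, `dL = 1` at all stages, `Isol` at stage 0 ONLY. DOES NOT USE: `p ≠ 2`
(every step is char-`p` additive algebra; the `p = 2` contact-form exception concerns `ConeExit`,
not this crux), `3 ≤ n` (n = 1: `dL = 1` forces `G = c u^p`, cleaned to `0`, contradiction with
MultP/OrdP; n = 2: verbatim), `PerfectField` (steps 1–3 are κ-rational algebra; for step 4 base-change
the run to the perfect closure: same states, same freeness, `Isol` is base-change invariant),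
`OrdP` (for `n ≥ 2`, `G = 0 ⇒ Linv = κ^n ⇒ dL = n ≠ 1`, so `dL = 1 ∧ MultP ⇒ OrdP`).

## 2. Attacks (all failed to kill; details in the seat NOTES.md §Census)
* PERIODIC / SELF-SIMILAR runs with `τ = 0` (pure exponent dynamics `T_i : B ↦ B + (|B|−B_i−p)e_i`,
  hyperbolic): a cone monomial survives `T_i` iff `B_i = 0`, so the cone is constant along a
  periodic `τ = 0` run and `e_i ∈ L` for every chart used; `dL = 1` ⇒ one chart ⇒ the axis arc ⇒
  the state lies in `(u')^p` ⇒ not isolated. The only fixed points ARE the non-isolated ones —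
  this is exactly the `Isol`-witness below.
* SATELLITE recurrence (the only escape from the arc): excluded by step 3 for `d = 1`.
* MODEL-LEVEL junk (truncated `tr`, `ℕ`-subtraction in `bl`, `sInf`, `finrank` of a span of
  κ-rational points over FINITE κ, `Classical.dec`): none changes the mathematics (§0).
* KNOWN MONSTERS: Hauser–Perlega cycles / kangaroo points are UNFORCED (non-isolated, e = 3) and
  never narrow; `ledger negatives --problem ResolutionOfSingularities`: 1 entry (DefectlessFrames),
  unrelated; barrier catalogue (`KangarooShadeIncrease`, `hauserPerlega_mohProofBoundFails`,
  `NarasimhanMaximalContact`, `DirectrixSmallCharacteristicNarrow`): none bites a statement that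
  tracks no order-type invariant and whose centres are κ-rational closed points.

## 3. Load-bearing analysis (theorems below)
* `Isol` — LOAD-BEARING, LANDED: `narrowRunsDie_false_without_Isol` (this namespace) :=
  `Theorems.NarrowRunsDie.Negative.narrowRunsDie_false_without_Isol` (p153198, axioms
  propext/Classical.choice/Quot.sound): over `𝔽₃`, `n = 3`, the state `u₁²u₂` is a fixed point of
  the step (chart 0, translation 0) with `MultP ∧ OrdP ∧ dL = 1` — an infinite narrow run, not
  isolated. So `Isol` must be used; stage `0` suffices (§1).
* `MultP` — LOAD-BEARING (paper proof, Lean near-miss `narrowRunsDie_false_without_MultP` below):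
  without `MultP` the dynamics may visit SMOOTH points (a linear monomial makes `Isol` trivial and
  `ord < p`, so `s = 0`: total transform, no division). For `p = n = 3` the set
  `S = {a | lin(a) ≠ 0, quad(a) ∉ κ·u_j² for some usable j, cubic(a) = u_i²·ℓ(u'), ℓ ≠ 0}` is
  forward-invariant under a generic step (chart `i'` with `quad ∉ κ u_{i'}²`, generic `τ`), and on it
  `OrdP ∧ dL = 1 ∧ Isol` hold (`L(u_i² ℓ) = {w_i = 0, ℓ(w) = 0}` is a line); so over an infinite
  (e.g. algebraically closed) `κ` an infinite run with `∀ m, Isol ∧ OrdP ∧ dL = 1` exists.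
* `dL = 1` — LOAD-BEARING by design: dropping it (keeping `Isol ∧ MultP ∧ OrdP`) is the route
  TARGET `IsolatedForcedTermination` on the order-`p` stratum = Hauser–Perlega's open forced-cycle
  question (arXiv:1802.05010 §1); no model is known to anyone; this seat found none (§2).
* NOT load-bearing: `p ≠ 2`, `3 ≤ n`, `PerfectField κ`, `OrdP`, `Isol` at stages `≥ 1` (§1) —
  recorded as the sharper conjecture `NarrowRunsDieSharp` (no theorem claimed).

## 4. Tightness / strengthenings (LANDED: `Negative/NoUniformBound.lean` + support files)
* The natural quantitative strengthening "∃ N(p, n), no run is narrow and isolated at every stage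
  m ≤ N" is FALSE — `narrowRunsDie_no_uniform_bound` (this namespace, := the landed
  `Theorems.NarrowRunsDie.Negative.Family.narrowRunsDie_no_uniform_bound`): over `𝔽₃`, `n = 3`, the
  FUEL FAMILY `a_k = u₀²u₁ + u₁³u₂ + u₀u₂^k` runs `a_(2N+3) ↦ a_(2N+1) ↦ … ↦ a_3` in chart `2` with
  translation `0` (`Negative/FuelFamilyRun.lean`: `step_cf`, `run_cf`), and every `a_k`, `k ≥ 3`, is
  narrow (`cone = X₀²X₁`, `Linv = {w₀ = w₁ = 0}`, `dL = 1`, forced direction `e₂` — the run IS the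
  forced one) and ISOLATED (`(∂a_k) ∋ X₀², X₁⁶, X₂^(2k)`; `Negative/FuelFamilyNarrow.lean`:
  `pd_*_cf`, `isol_cf`, via the reusable certificate `Negative/JacobianQuotientFinite.lean`:
  `moduleFinite_quotient_of_X_pow_mem`). Milnor-type numbers `6k` (python `exp/dyn.py`: 54, 42, 30,
  18, 6). So the crux hypotheses are jointly satisfiable on every finite prefix, and any termination
  bound must depend on the start (the derivlift line's `D + 2` does: here `D ~ 2k`).
* CAUTION (correction to the crux census): `u₀²u₁ + u₁⁴ + u₂^N` is isolated at stages 0 and 1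
  only (`u₁⁴ ↦ u₁⁴u₂^m`; at `m ≥ 2` all partials die on the `u₁`-axis). More generally EVERY state in
  `(u₀,u₁)³·κ[[u₂]] + κ[[u₂]]` is non-isolated: Euler (`u₀∂₀ + u₁∂₁ = 3·(…) = 0`) is a syzygy, so
  `∂₀ = u₁q`, `∂₁ = −u₀q` and `ht(∂a) ≤ 2`; the fuel `u₀u₂^k` (`B₀ + B₁ = 1 ≢ 0 mod 3`) breaks it.
  This is the same Euler degeneracy the route's Chern lemma exploits, seen from the refuter's side:
  it constrains which explicit witnesses CAN be isolated (useful for `ConeExit` kill attempts).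

## 5. Targets
None yet (payload `stuck_stubs = []`; line `derivlift` registered, 5 stubs). Paper check of the two
one-step stubs AS TYPED: `Sig.stub_nearInvariant` and `Sig.stub_transversal` are sound (the latter
needs neither `MultP` of the successor nor `OrdP`: `cone (step i τ c) ≡ cone c|_{u_i=0} mod u_i`
holds as soon as `s = p`). The formalisation risk sits in `stub_frobeniusCoset` (dictionary), not in
a false stub.
-/

noncomputable section

set_option linter.dupNamespace false

namespace Summit.ResolutionOfSingularities.ResolutionOfSingularities.Cruxes.NarrowRunsDie.Disproof

open Summit.ResolutionOfSingularities.ResolutionOfSingularities.Theses.WildCones (NarrowRunsDie)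

/-! ## (a) Load-bearing hypotheses -/

/-- `NarrowRunsDie` with the conjunct `Isol (run c₀ i t m)` DELETED from its first hypothesis
(everything else verbatim; the then-unused lets `ser pd jac Isol` omitted). FALSE:
`narrowRunsDie_false_without_Isol`. -/
def NarrowRunsDieWithoutIsol : Prop :=
  ∀ p : ℕ, p.Prime → p ≠ 2 → ∀ n : ℕ, 3 ≤ n → ∀ (κ : Type) [Field κ] [CharP κ p] [PerfectField κ] (c₀ : (Fin n → ℕ) → κ) (i : ℕ → Fin n) (t : ℕ → Fin n → κ), let clean : ((Fin n → ℕ) → κ) → ((Fin n → ℕ) → κ) := fun c A => @ite κ (∀ j, p ∣ A j) (Classical.dec _) 0 (c A); let bl : Fin n → ((Fin n → ℕ) → κ) → ((Fin n → ℕ) → κ) := fun i c B => @ite κ (Finset.sum (Finset.univ.erase i) (fun j => B j) ≤ B i) (Classical.dec _) (c (Function.update B i (B i - Finset.sum (Finset.univ.erase i) (fun j => B j)))) 0; let ord : ((Fin n → ℕ) → κ) → ℕ := fun c => sInf {m : ℕ | ∃ A, c A ≠ 0 ∧ m = Finset.sum Finset.univ (fun j => A j)}; let dv : Fin n → ℕ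 → ((Fin n → ℕ) → κ) → ((Fin n → ℕ) → κ) := fun i s c B => c (Function.update B i (B i + s)); let tr : Fin n → (Fin n → κ) → ℕ → ((Fin n → ℕ) → κ) → ((Fin n → ℕ) → κ) := fun i τ s c B => Finset.sum (Fintype.piFinset (fun _ : Fin n => Finset.range (B i + s + 1))) (fun D => @ite κ (D i = 0) (Classical.dec _) (c (B + D) * Finset.prod (Finset.univ.erase i) (fun j => ((Nat.choose (B j + D j) (B j) : ℕ) : κ) * τ j ^ (D j))) 0); let step : Fin n → (Fin n → κ) → ((Fin n → ℕ) → κ) → ((Fin n → ℕ) → κ) := fun i τ c => clean (tr i τ (@ite ℕ (p ≤ ord (clean c)) (Classical.dec _) p 0) (dv i (@ite ℕ (p ≤ ord (clean c)) (Classical.dec _) p 0) (bl i (clean c)))); let run : ((Fin n → ℕ) → κ) → (ℕ → Fin n) → (ℕ → Fin n → κ) → ℕ → ((Fin n → ℕ) → κ) := fun c₀ i t m => @Nat.rec (fun _ => (Fin n → ℕ) → κ) c₀ (fun m c => step (i m) (t m) c) m; let MultP : ((Fin n → ℕ) → κ) → Prop := fun c => (∃ A, clean c A ≠ 0) ∧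 ∀ A, clean c A ≠ 0 → p ≤ Finset.sum Finset.univ (fun j => A j); let OrdP : ((Fin n → ℕ) → κ) → Prop := fun c => ∃ A, clean c A ≠ 0 ∧ Finset.sum Finset.univ (fun j => A j) = p; let cone : ((Fin n → ℕ) → κ) → MvPolynomial (Fin n) κ := fun c => Finset.sum (Fintype.piFinset (fun _ : Fin n => Finset.range (p + 1))) (fun A => @ite (MvPolynomial (Fin n) κ) (Finset.sum Finset.univ (fun j => A j) = p) (Classical.dec _) (MvPolynomial.monomial (Finsupp.equivFunOnFinite.symm A) (clean c A)) 0); let Linv : ((Fin n → ℕ) → κ) → Set (Fin n → κ) := fun c => {w : Fin n → κ | MvPolynomial.aeval (fun j : Fin n => (MvPolynomial.X (some j) : MvPolynomial (Option (Fin n)) κ) + MvPolynomial.C (w j) * MvPolynomial.X none) (cone c) = MvPolynomial.rename some (cone c) + MvPolynomial.C (MvPolynomial.eval w (cone c)) * (MvPolynomial.X none) ^ p}; let dL : ((Fin n → ℕ) → κ) → ℕ := fun c => Module.finrank κ (Submodule.span κ (Linv c)); (∀ m, MultP (run c₀ i t m)) → (∀ m, OrdP (run c₀ i t m) ∧ dL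 (run c₀ i t m) = 1) → False

/-- **Any proof of `NarrowRunsDie` must use `Isol`.** The `Isol`-less statement is false: over
`𝔽₃`, `n = 3`, the one-monomial state `u₁²u₂` (chart word `≡ 0`, translation word `≡ 0`) is a
fixed point of the step with `MultP ∧ OrdP ∧ dL = 1` at every stage (landed as
`Theorems/NarrowRunsDie/Negative/FalseWithoutIsol.lean`, p153198). -/
theorem narrowRunsDie_false_without_Isol : ¬ NarrowRunsDieWithoutIsol :=
  Summit.ResolutionOfSingularities.ResolutionOfSingularities.Theorems.NarrowRunsDie.Negative.narrowRunsDie_false_without_Isol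

/-- `NarrowRunsDie` with the conjunct `MultP (run c₀ i t m)` DELETED from its first hypothesis
(everything else verbatim; the then-unused let `MultP` omitted). Believed FALSE (paper proof in the module docstring §3: smooth-point
runs); see the near-miss `narrowRunsDie_false_without_MultP`. -/
def NarrowRunsDieWithoutMultP : Prop :=
  ∀ p : ℕ, p.Prime → p ≠ 2 → ∀ n : ℕ, 3 ≤ n → ∀ (κ : Type) [Field κ] [CharP κ p] [PerfectField κ] (c₀ : (Fin n → ℕ) → κ) (i : ℕ → Fin n) (t : ℕ → Fin n → κ), let clean : ((Fin n → ℕ) → κ) → ((Fin n → ℕ) → κ) := fun c A => @ite κ (∀ j, p ∣ A j) (Classical.dec _) 0 (c A); let bl : Fin n → ((Fin n → ℕ) → κ) → ((Fin n → ℕ) → κ) := fun i c B => @ite κ (Finset.sum (Finset.univ.erase i) (fun j => B j) ≤ B i) (Classical.dec _) (c (Function.update B i (B i - Finset.sum (Finset.univ.erase i) (fun j => B j)))) 0; let ord : ((Fin n → ℕ) → κ) → ℕ := fun c => sInf {m : ℕ | ∃ A, c A ≠ 0 ∧ m = Finset.sum Finset.univ (fun j => A j)}; let dv : Fin n → ℕ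 → ((Fin n → ℕ) → κ) → ((Fin n → ℕ) → κ) := fun i s c B => c (Function.update B i (B i + s)); let tr : Fin n → (Fin n → κ) → ℕ → ((Fin n → ℕ) → κ) → ((Fin n → ℕ) → κ) := fun i τ s c B => Finset.sum (Fintype.piFinset (fun _ : Fin n => Finset.range (B i + s + 1))) (fun D => @ite κ (D i = 0) (Classical.dec _) (c (B + D) * Finset.prod (Finset.univ.erase i) (fun j => ((Nat.choose (B j + D j) (B j) : ℕ) : κ) * τ j ^ (D j))) 0); let step : Fin n → (Fin n → κ) → ((Fin n → ℕ) → κ) → ((Fin n → ℕ) → κ) := fun i τ c => clean (tr i τ (@ite ℕ (p ≤ ord (clean c)) (Classical.dec _) p 0) (dv i (@ite ℕ (p ≤ ord (clean c)) (Classical.dec _) p 0) (bl i (clean c)))); let run : ((Fin n → ℕ) → κ) → (ℕ → Fin n) → (ℕ → Fin n → κ) → ℕ → ((Fin n → ℕ) → κ) := fun c₀ i t m => @Nat.rec (fun _ => (Fin n → ℕ) → κ) c₀ (fun m c => step (i m) (t m) c) m; let ser : ((Fin n → ℕ) → κ) → MvPowerSeries (Fin n) κ := fun c => show MvPowerSeries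 (Fin n) κ from fun A : Fin n →₀ ℕ => clean c ⇑A; let pd : Fin n → MvPowerSeries (Fin n) κ → MvPowerSeries (Fin n) κ := fun i f => show MvPowerSeries (Fin n) κ from fun A : Fin n →₀ ℕ => ((A i + 1 : ℕ) : κ) * f (A + Finsupp.single i 1); let jac : ((Fin n → ℕ) → κ) → Ideal (MvPowerSeries (Fin n) κ) := fun c => Ideal.span (Set.range (fun i => pd i (ser c))); let Isol : ((Fin n → ℕ) → κ) → Prop := fun c => Module.Finite κ (MvPowerSeries (Fin n) κ ⧸ jac c); let OrdP : ((Fin n → ℕ) → κ) → Prop := fun c => ∃ A, clean c A ≠ 0 ∧ Finset.sum Finset.univ (fun j => A j) = p; let cone : ((Fin n → ℕ) → κ) → MvPolynomial (Fin n) κ := fun c => Finset.sum (Fintype.piFinset (fun _ : Fin n => Finset.range (p + 1))) (fun A => @ite (MvPolynomial (Fin n) κ) (Finset.sum Finset.univ (fun j => A j) = p) (Classical.dec _) (MvPolynomial.monomial (Finsupp.equivFunOnFinite.symm A) (clean c A)) 0); let Linv : ((Fin n → ℕ) → κ) → Set (Fin n → κ) := fun c => {w : Fin n → κ | MvPolynomial.aeval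 (fun j : Fin n => (MvPolynomial.X (some j) : MvPolynomial (Option (Fin n)) κ) + MvPolynomial.C (w j) * MvPolynomial.X none) (cone c) = MvPolynomial.rename some (cone c) + MvPolynomial.C (MvPolynomial.eval w (cone c)) * (MvPolynomial.X none) ^ p}; let dL : ((Fin n → ℕ) → κ) → ℕ := fun c => Module.finrank κ (Submodule.span κ (Linv c)); (∀ m, Isol (run c₀ i t m)) → (∀ m, OrdP (run c₀ i t m) ∧ dL (run c₀ i t m) = 1) → False

/-- NEAR-MISS (paper-proved, not closed in Lean). Without `MultP` the run may consist of SMOOTH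
points: a state with a linear monomial has `Isol` trivially (a unit partial) and `ord < p`, so the
step is the total transform (`s = 0`, no division); for `p = n = 3` the shape
`lin = λ u_i`, `quad = u_i Λ(u') + q u_i²`, `cubic = u_i² ℓ(u')` reproduces itself under a chart
change with generic translation, with `ℓ' = Σ_{j ≠ i'} ∂_j quad(e_{i'} + u')(τ') u_j ≠ 0` as soon as
`quad ∉ κ u_{i'}²`, and `L(u_{i'}² ℓ') = {w_{i'} = 0, ℓ'(w) = 0}` is a line (`dL = 1`). Over an
algebraically closed `κ` of characteristic `3` this yields an infinite run with
`∀ m, Isol ∧ OrdP ∧ dL = 1`. OBSTRUCTION to closing it here: a kernel-checked witness needs either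
a PERIODIC full state (impossible: without division the total degree mass only grows) or the lemma
"the degree-`≤ 3` truncation of `step` depends only on the degree-`≤ 3` truncation when `s = 0`"
plus an explicit periodic orbit of truncations over a finite field (search not run: 3^16 states ×
9 moves over `𝔽₃`); the `tr` sum with `τ ≠ 0` has no evaluation lemma yet (only `tr_zero`).
What was tried: the `τ = 0` sub-dynamics cannot work (linear terms survive only along a constant
chart, and then the cubic part dies in two steps). -/
theorem narrowRunsDie_false_without_MultP : ¬ NarrowRunsDieWithoutMultP := by
  sorry

/-! `dL = 1` dropped: `(∀ m, Isol ∧ MultP) → (∀ m, OrdP) → False` is the route TARGET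
`IsolatedForcedTermination` on the order-`p` stratum (open; no statement is made here). -/

/-! ## (b)/(c) Tightness: no uniform bound on the length of narrow isolated runs -/

/-- The natural quantitative strengthening of the crux: a ∀ p : ℕ, p.Prime → p ≠ 2 → ∀ n : ℕ, 3 ≤ n → ∀ (κ : Type) [Field κ] [CharP κ p] [PerfectField κ] (c₀ : (Fin n → ℕ) → κ) (i : ℕ → Fin n) (t : ℕ → Fin n → κ), let clean : ((Fin n → ℕ) → κ) → ((Fin n → ℕ) → κ) := fun c A => @ite κ (∀ j, p ∣ A j) (Classical.dec _) 0 (c A); let bl : Fin n → ((Fin n → ℕ) → κ) → ((Fin n → ℕ) → κ) := fun i c B => @ite κ (Finset.sum (Finset.univ.erase i) (fun j => B j) ≤ B i) (Classical.dec _) (c (Function.update B i (B i - Finset.sum (Finset.univ.erase i) (fun j => B j)))) 0; let ord : ((Fin n → ℕ) → κ) → ℕ := fun c => sInf {m : ℕ | ∃ A, c A ≠ 0 ∧ m = Finset.sum Finset.univ (fun j => A j)}; let dv : Fin n → ℕ → ((Fin n → ℕ) → κ) → ((Fin n → ℕ) → κ) := fun i s c B => c (Function.update B i (B i + s)); let tr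 : Fin n → (Fin n → κ) → ℕ → ((Fin n → ℕ) → κ) → ((Fin n → ℕ) → κ) := fun i τ s c B => Finset.sum (Fintype.piFinset (fun _ : Fin n => Finset.range (B i + s + 1))) (fun D => @ite κ (D i = 0) (Classical.dec _) (c (B + D) * Finset.prod (Finset.univ.erase i) (fun j => ((Nat.choose (B j + D j) (B j) : ℕ) : κ) * τ j ^ (D j))) 0); let step : Fin n → (Fin n → κ) → ((Fin n → ℕ) → κ) → ((Fin n → ℕ) → κ) := fun i τ c => clean (tr i τ (@ite ℕ (p ≤ ord (clean c)) (Classical.dec _) p 0) (dv i (@ite ℕ (p ≤ ord (clean c)) (Classical.dec _) p 0) (bl i (clean c)))); let run : ((Fin n → ℕ) → κ) → (ℕ → Fin n) → (ℕ → Fin n → κ) → ℕ → ((Fin n → ℕ) → κ) := fun c₀ i t m => @Nat.rec (fun _ => (Fin n → ℕ) → κ) c₀ (fun m c => step (i m) (t m) c) m; let ser : ((Fin n → ℕ) → κ) → MvPowerSeries (Fin n) κ := fun c => show MvPowerSeries (Fin n) κ from fun A : Fin n →₀ ℕ => clean c ⇑A; let pd : Fin n → MvPowerSeries (Fin n) κ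 → MvPowerSeries (Fin n) κ := fun i f => show MvPowerSeries (Fin n) κ from fun A : Fin n →₀ ℕ => ((A i + 1 : ℕ) : κ) * f (A + Finsupp.single i 1); let jac : ((Fin n → ℕ) → κ) → Ideal (MvPowerSeries (Fin n) κ) := fun c => Ideal.span (Set.range (fun i => pd i (ser c))); let Isol : ((Fin n → ℕ) → κ) → Prop := fun c => Module.Finite κ (MvPowerSeries (Fin n) κ ⧸ jac c); let MultP : ((Fin n → ℕ) → κ) → Prop := fun c => (∃ A, clean c A ≠ 0) ∧ ∀ A, clean c A ≠ 0 → p ≤ Finset.sum Finset.univ (fun j => A j); let OrdP : ((Fin n → ℕ) → κ) → Prop := fun c => ∃ A, clean c A ≠ 0 ∧ Finset.sum Finset.univ (fun j => A j) = p; let cone : ((Fin n → ℕ) → κ) → MvPolynomial (Fin n) κ := fun c => Finset.sum (Fintype.piFinset (fun _ : Fin n => Finset.range (p + 1))) (fun A => @ite (MvPolynomial (Fin n) κ) (Finset.sum Finset.univ (fun j => A j) = p) (Classical.dec _) (MvPolynomial.monomial (Finsupp.equivFunOnFinite.symm A) (clean c A)) 0); let Linv : ((Fin n → ℕ) → κ)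 → Set (Fin n → κ) := fun c => {w : Fin n → κ | MvPolynomial.aeval (fun j : Fin n => (MvPolynomial.X (some j) : MvPolynomial (Option (Fin n)) κ) + MvPolynomial.C (w j) * MvPolynomial.X none) (cone c) = MvPolynomial.rename some (cone c) + MvPolynomial.C (MvPolynomial.eval w (cone c)) * (MvPolynomial.X none) ^ p}; let dL : ((Fin n → ℕ) → κ) → ℕ := fun c => Module.finrank κ (Submodule.span κ (Linv c)); ¬ (∀ m, m ≤ N → (Isol (run c₀ i t m) ∧ MultP (run c₀ i t m)) ∧ (OrdP (run c₀ i t m) ∧ dL (run c₀ i t m) = 1))ORM `N` beyond which no run stays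
narrow and isolated (crux calculus verbatim; `N` the only new binder). FALSE:
`narrowRunsDie_no_uniform_bound`. -/
def NarrowRunsDieUniformBound : Prop :=
  ∃ N : ℕ, ∀ p : ℕ, p.Prime → p ≠ 2 → ∀ n : ℕ, 3 ≤ n → ∀ (κ : Type) [Field κ] [CharP κ p] [PerfectField κ] (c₀ : (Fin n → ℕ) → κ) (i : ℕ → Fin n) (t : ℕ → Fin n → κ), let clean : ((Fin n → ℕ) → κ) → ((Fin n → ℕ) → κ) := fun c A => @ite κ (∀ j, p ∣ A j) (Classical.dec _) 0 (c A); let bl : Fin n → ((Fin n → ℕ) → κ) → ((Fin n → ℕ) → κ) := fun i c B => @ite κ (Finset.sum (Finset.univ.erase i) (fun j => B j) ≤ B i) (Classical.dec _) (c (Function.update B i (B i - Finset.sum (Finset.univ.erase i) (fun j => B j)))) 0; let ord : ((Fin n → ℕ) → κ) → ℕ := fun c => sInf {m : ℕ | ∃ A, c A ≠ 0 ∧ m = Finset.sum Finset.univ (fun j => A j)}; let dv : Fin n → ℕ → ((Fin n → ℕ) → κ) → ((Fin n → ℕ) → κ) := fun i s c B => c (Function.update B i (B i + s)); let tr : Fin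 n → (Fin n → κ) → ℕ → ((Fin n → ℕ) → κ) → ((Fin n → ℕ) → κ) := fun i τ s c B => Finset.sum (Fintype.piFinset (fun _ : Fin n => Finset.range (B i + s + 1))) (fun D => @ite κ (D i = 0) (Classical.dec _) (c (B + D) * Finset.prod (Finset.univ.erase i) (fun j => ((Nat.choose (B j + D j) (B j) : ℕ) : κ) * τ j ^ (D j))) 0); let step : Fin n → (Fin n → κ) → ((Fin n → ℕ) → κ) → ((Fin n → ℕ) → κ) := fun i τ c => clean (tr i τ (@ite ℕ (p ≤ ord (clean c)) (Classical.dec _) p 0) (dv i (@ite ℕ (p ≤ ord (clean c)) (Classical.dec _) p 0) (bl i (clean c)))); let run : ((Fin n → ℕ) → κ) → (ℕ → Fin n) → (ℕ → Fin n → κ) → ℕ → ((Fin n → ℕ) → κ) := fun c₀ i t m => @Nat.rec (fun _ => (Fin n → ℕ) → κ) c₀ (fun m c => step (i m) (t m) c) m; let ser : ((Fin n → ℕ) → κ) → MvPowerSeries (Fin n) κ := fun c => show MvPowerSeries (Fin n) κ from fun A : Fin n →₀ ℕ => clean c ⇑A; let pd : Fin n → MvPowerSeries (Fin n) κ → MvPowerSeries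 (Fin n) κ := fun i f => show MvPowerSeries (Fin n) κ from fun A : Fin n →₀ ℕ => ((A i + 1 : ℕ) : κ) * f (A + Finsupp.single i 1); let jac : ((Fin n → ℕ) → κ) → Ideal (MvPowerSeries (Fin n) κ) := fun c => Ideal.span (Set.range (fun i => pd i (ser c))); let Isol : ((Fin n → ℕ) → κ) → Prop := fun c => Module.Finite κ (MvPowerSeries (Fin n) κ ⧸ jac c); let MultP : ((Fin n → ℕ) → κ) → Prop := fun c => (∃ A, clean c A ≠ 0) ∧ ∀ A, clean c A ≠ 0 → p ≤ Finset.sum Finset.univ (fun j => A j); let OrdP : ((Fin n → ℕ) → κ) → Prop := fun c => ∃ A, clean c A ≠ 0 ∧ Finset.sum Finset.univ (fun j => A j) = p; let cone : ((Fin n → ℕ) → κ) → MvPolynomial (Fin n) κ := fun c => Finset.sum (Fintype.piFinset (fun _ : Fin n => Finset.range (p + 1))) (fun A => @ite (MvPolynomial (Fin n) κ) (Finset.sum Finset.univ (fun j => A j) = p) (Classical.dec _) (MvPolynomial.monomial (Finsupp.equivFunOnFinite.symm A) (clean c A)) 0); let Linv : ((Fin n → ℕ) → κ) → Set (Fin n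 → κ) := fun c => {w : Fin n → κ | MvPolynomial.aeval (fun j : Fin n => (MvPolynomial.X (some j) : MvPolynomial (Option (Fin n)) κ) + MvPolynomial.C (w j) * MvPolynomial.X none) (cone c) = MvPolynomial.rename some (cone c) + MvPolynomial.C (MvPolynomial.eval w (cone c)) * (MvPolynomial.X none) ^ p}; let dL : ((Fin n → ℕ) → κ) → ℕ := fun c => Module.finrank κ (Submodule.span κ (Linv c)); ¬ (∀ m, m ≤ N → (Isol (run c₀ i t m) ∧ MultP (run c₀ i t m)) ∧ (OrdP (run c₀ i t m) ∧ dL (run c₀ i t m) = 1))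

/-- **No uniform bound** (landed as `Theorems/NarrowRunsDie/Negative/NoUniformBound.lean`): for every
`N` the fuel-family run `a_(2N+3) ↦ … ↦ a_3` over `𝔽₃` is isolated and narrow at all stages
`m ≤ N`. -/
theorem narrowRunsDie_no_uniform_bound : ¬ NarrowRunsDieUniformBound :=
  Summit.ResolutionOfSingularities.ResolutionOfSingularities.Theorems.NarrowRunsDie.Negative.Family.narrowRunsDie_no_uniform_bound

/-! ## (d) The sharper form the proof of §1 actually gives (conjecture, for the lead; NOT a
theorem, NOT a route item): every prime `p` (also `2`), every `n ≥ 1`, every field of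
characteristic `p` (perfectness unused), `Isol` at stage `0` only, no `OrdP`. Recorded so that
provers do not case-split on `p = 2` / small `n`, and so that a refuter of THIS form (which would
not refute the crux) knows where the slack is. -/

/-- The sharpened statement that steps 1–4 of the module docstring prove on paper. -/
def NarrowRunsDieSharp : Prop :=
  ∀ p : ℕ, p.Prime → ∀ n : ℕ, 0 < n → ∀ (κ : Type) [Field κ] [CharP κ p] (c₀ : (Fin n → ℕ) → κ) (i : ℕ → Fin n) (t : ℕ → Fin n → κ), let clean : ((Fin n → ℕ) → κ) → ((Fin n → ℕ) → κ) := fun c A => @ite κ (∀ j, p ∣ A j) (Classical.dec _) 0 (c A); let bl : Fin n → ((Fin n → ℕ) → κ) → ((Fin n → ℕ) → κ) := fun i c B => @ite κ (Finset.sum (Finset.univ.erase i) (fun j => B j) ≤ B i) (Classical.dec _) (c (Function.update B i (B i - Finset.sum (Finset.univ.erase i) (fun j => B j)))) 0; let ord : ((Fin n → ℕ) → κ) → ℕ := fun c => sInf {m : ℕ | ∃ A, c A ≠ 0 ∧ m = Finset.sum Finset.univ (fun j => A j)}; let dv : Fin n → ℕ → ((Fin n → ℕ) → κ) → ((Fin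 n → ℕ) → κ) := fun i s c B => c (Function.update B i (B i + s)); let tr : Fin n → (Fin n → κ) → ℕ → ((Fin n → ℕ) → κ) → ((Fin n → ℕ) → κ) := fun i τ s c B => Finset.sum (Fintype.piFinset (fun _ : Fin n => Finset.range (B i + s + 1))) (fun D => @ite κ (D i = 0) (Classical.dec _) (c (B + D) * Finset.prod (Finset.univ.erase i) (fun j => ((Nat.choose (B j + D j) (B j) : ℕ) : κ) * τ j ^ (D j))) 0); let step : Fin n → (Fin n → κ) → ((Fin n → ℕ) → κ) → ((Fin n → ℕ) → κ) := fun i τ c => clean (tr i τ (@ite ℕ (p ≤ ord (clean c)) (Classical.dec _) p 0) (dv i (@ite ℕ (p ≤ ord (clean c)) (Classical.dec _) p 0) (bl i (clean c)))); let run : ((Fin n → ℕ) → κ) → (ℕ → Fin n) → (ℕ → Fin n → κ) → ℕ → ((Fin n → ℕ) → κ) := fun c₀ i t m => @Nat.rec (fun _ => (Fin n → ℕ) → κ) c₀ (fun m c => step (i m) (t m) c) m; let ser : ((Fin n → ℕ) → κ) → MvPowerSeries (Fin n) κ := fun c => show MvPowerSeries (Fin n) κ from fun A : Fin n →₀ ℕ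 => clean c ⇑A; let pd : Fin n → MvPowerSeries (Fin n) κ → MvPowerSeries (Fin n) κ := fun i f => show MvPowerSeries (Fin n) κ from fun A : Fin n →₀ ℕ => ((A i + 1 : ℕ) : κ) * f (A + Finsupp.single i 1); let jac : ((Fin n → ℕ) → κ) → Ideal (MvPowerSeries (Fin n) κ) := fun c => Ideal.span (Set.range (fun i => pd i (ser c))); let Isol : ((Fin n → ℕ) → κ) → Prop := fun c => Module.Finite κ (MvPowerSeries (Fin n) κ ⧸ jac c); let MultP : ((Fin n → ℕ) → κ) → Prop := fun c => (∃ A, clean c A ≠ 0) ∧ ∀ A, clean c A ≠ 0 → p ≤ Finset.sum Finset.univ (fun j => A j); let cone : ((Fin n → ℕ) → κ) → MvPolynomial (Fin n) κ := fun c => Finset.sum (Fintype.piFinset (fun _ : Fin n => Finset.range (p + 1))) (fun A => @ite (MvPolynomial (Fin n) κ) (Finset.sum Finset.univ (fun j => A j) = p) (Classical.dec _) (MvPolynomial.monomial (Finsupp.equivFunOnFinite.symm A) (clean c A)) 0); let Linv : ((Fin n → ℕ) → κ) → Set (Fin n → κ) := fun c => {w : Fin n → κ | MvPolynomial.aeval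 (fun j : Fin n => (MvPolynomial.X (some j) : MvPolynomial (Option (Fin n)) κ) + MvPolynomial.C (w j) * MvPolynomial.X none) (cone c) = MvPolynomial.rename some (cone c) + MvPolynomial.C (MvPolynomial.eval w (cone c)) * (MvPolynomial.X none) ^ p}; let dL : ((Fin n → ℕ) → κ) → ℕ := fun c => Module.finrank κ (Submodule.span κ (Linv c)); Isol (run c₀ i t 0) → (∀ m, MultP (run c₀ i t m)) → (∀ m, dL (run c₀ i t m) = 1) → False

/-- Sanity (kernel-checked): the sharp form implies the crux verbatim. -/
theorem narrowRunsDie_of_sharp : NarrowRunsDieSharp → NarrowRunsDie := by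
  intro h p hp _ n hn κ _ _ _ c₀ i t clean bl ord dv tr step run ser pd jac Isol MultP OrdP cone Linv dL
    hall hnar
  exact h p hp n (by omega) κ c₀ i t (hall 0).1 (fun m => (hall m).2) (fun m => (hnar m).2)

end Summit.ResolutionOfSingularities.ResolutionOfSingularities.Cruxes.NarrowRunsDie.Disproof

end
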